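/-
Copyright (c) 2026. All rights reserved.
Released under Apache 2.0 license as described in the file LICENSE.
-/
import Literature.NumberTheory.GaloisRepresentations.HOneRestrictionOntoInvariants
import Literature.NumberTheory.GaloisRepresentations.PadicQuotientHOneCoinvariants
import Literature.NumberTheory.GaloisRepresentations.CoinducedModule
import Literature.GroupTheory.PadicQuotientSectionProofs
import HarnessLib

/-!
# `H¹(G, B) → H¹(N, B)^{G/N}` is onto for `G ⧸ N ≅ ℤ_p` and `B` a finite discrete `p`-primary module

Topic `NumberTheory/GaloisRepresentations`; namespace `Literature.NumberTheory.GaloisRepresentations`.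
THEOREMS ONLY (no definition, no named fact).  The `ℤ_p`-quotient companion of
`HOneRestrictionOntoInvariantsFinite.lean` (which treats free procyclic quotients `G ⧸ N ≅ Ẑ`): the
surjectivity theorem `exists_resSubgroup_eq_of_conjMap_eq` of `HOneRestrictionOntoInvariants.lean` is
stated under a continuous retraction `r : G → C` onto a procyclic complement `C = cl⟨ψ⟩` with kernel `N`
and the hypothesis (KM4) "every `t` is the value at `ψ` of a continuous cocycle of `C`".  Here both are
DISCHARGED when the quotient is cut out by a continuous character `κ : G → ℤ_p` (`N = ker κ`) and the
coefficients are finite, discrete and `p`-primary: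

* `exists_contOneCocycles_apply_eq_of_padicInt` — (KM4) for `ℤ_p`: for a compact group `G` with a
  continuous surjection `φ : G ↠ ℤ_p` whose kernel acts trivially on the discrete `p`-primary module
  `D`, and `φ γ = 1`, every `d ∈ D` is `z(γ)` for a continuous `1`-cocycle `z` of `G` (Serre's geometric
  cocycle `σ ↦ Σ_{j < idx σ} γʲ d` on a deep enough layer `φ⁻¹(p^m ℤ_p)`, whose norm
  `Σ_{j<p^m} γʲ d = p^e • Σ_{j<p^n} γʲ d` vanishes);
* **`exists_resSubgroup_eq_of_conjMap_eq_of_padicInt`**,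
  `exists_resSubgroup_eq_iff_forall_conjMap_eq_of_padicInt` — for `G` profinite,
  `κ : G → ℤ_p` continuous with `N = ker κ` and `κ γ = 1`, and `B` a finite discrete `G`-module killed
  by a power of `p`: **every `γ`-invariant class of `H¹(N, B)` is the restriction of a class of
  `H¹(G, B)`**, i.e. `0 → H¹(G/N, B^N) → H¹(G, B) → H¹(N, B)^{Γ} → 0` (`Γ = G ⧸ N ≅ ℤ_p`) is exact on
  the right — the inflation-restriction sequence with `H²(ℤ_p, B^N) = 0` (`cd_p ℤ_p = 1`), the form in
  which it is used for the cyclotomic `ℤ_p`-extension in Iwasawa theory (Greenberg, LNM 1716, §3–§4: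
  `H¹(K_Σ/K, M) → H¹(K_Σ/K_∞, M)^Γ` and its local analogues at `v ∤ p` are surjective).
  The complement `C ≅ ℤ_p` and the retraction are supplied by the continuous section of `κ` through the
  `p`-part of `γ` (`Literature.GroupTheory.exists_continuousMonoidHom_section_padicInt`); no freeness
  of `G ⧸ N` beyond `≅ ℤ_p` and no `Ẑ`-structure is needed.

[cite: SerreLocalFields1979, XIII §1 Prop. 1] [cite: NeukirchSchmidtWingberg2008, (1.6.7)]
[cite: GreenbergLNM1716, §3 (inflation–restriction for `Γ ≅ ℤ_p`), §4 Lemma 4.6]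
-/

noncomputable section

open CategoryTheory Function

universe u

namespace Literature.NumberTheory.GaloisRepresentations

open Literature.GroupTheory
open _root_.Subgroup _root_.Topology _root_.TopRep _root_.ContinuousCohomology

/-! ### (KM4) for `ℤ_p`: every `d` is the value at `γ` of a continuous cocycle -/

section KM4

variable {G : Type u} [Group G] [TopologicalSpace G] [IsTopologicalGroup G] [CompactSpace G]
  {p : ℕ} [hp : Fact p.Prime] (φ : G →ₜ* Multiplicative ℤ_[p])
variable {D : Type u} [AddCommGroup D] [TopologicalSpace D] [DiscreteTopology D]
  (τ : ContinuousRep G ℤ D)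

omit [TopologicalSpace G] [IsTopologicalGroup G] [CompactSpace G] in
/-- `n • S(i) = Σ_{j<i} γʲ (n • d) = 0` if `n • d = 0`. [folklore] -/
private theorem nsmul_geomSum_eq_zero' {X : TopRep.{u} ℤ G} (F : G) (b₀ : X) {n : ℕ} (hn : n • b₀ = 0)
    (i : ℕ) : n • geomSum F b₀ i = 0 := by
  induction i with
  | zero => rw [geomSum_zero, smul_zero]
  | succ i ih => rw [geomSum_succ, smul_add, ih, zero_add, ← map_nsmul, hn, map_zero]

/-- **(KM4) for a `ℤ_p`-quotient** (Serre, *Corps locaux* XIII §1 Prop. 1, surjective direction, the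
`ℤ_p`-case): `G` compact, `φ : G ↠ ℤ_p` a continuous surjection whose kernel acts trivially on the
discrete module `D`, every element of which is killed by a power of `p`, and `φ γ = 1 ∈ ℤ_p`.  Then every
`d ∈ D` is the value at `γ` of a continuous `1`-cocycle of `G`: `d` is fixed by a layer
`L_n = φ⁻¹(p^n ℤ_p)` and killed by `p^e`; with `m = n + e` the norm `Σ_{j<p^m} γʲ d = p^e • Σ_{j<p^n} γʲ d`
vanishes, so the geometric cocycle `σ ↦ Σ_{j < idx σ} γʲ d` of the cyclic group `G ⧸ L_m = ⟨γ̄⟩`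
(order `p^m`), with values in `D^{L_m}`, is a continuous cocycle of `G` taking the value `d` at `γ`.
[cite: SerreLocalFields1979, XIII §1 Prop. 1] [cite: GreenbergLNM1716, §4 Appendix pp. 116–117] -/
theorem exists_contOneCocycles_apply_eq_of_padicInt (hφ : Surjective φ)
    (hker : ∀ g : G, φ g = 1 → ∀ b : D, τ g b = b) {γ : G} (hγ : φ γ = Multiplicative.ofAdd 1)
    (hD : ∀ d : D, ∃ e : ℕ, p ^ e • d = 0) (d : D) :
    ∃ z : contOneCocycles τ.toTopRep, z.1 γ = d := by
  classical
  -- the stabiliser of `d`: an open subgroup containing `ker φ`, hence containing a layer `L_n`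
  let S : Subgroup G :=
    { carrier := {g | τ g d = d}
      one_mem' := by change τ 1 d = d; rw [map_one]; rfl
      mul_mem' := fun {a b} ha hb => by
        change τ (a * b) d = d
        rw [map_mul, Module.End.mul_apply, show τ b d = d from hb, show τ a d = d from ha]
      inv_mem' := fun {a} ha => by
        change τ a⁻¹ d = d
        have h : τ a⁻¹ (τ a d) = d := by
          rw [← Module.End.mul_apply, ← map_mul, inv_mul_cancel, map_one]; rfl
        rwa [show τ a d = d from ha] at h }
  have hSopen : IsOpen (S : Set G) := τ.isOpen_setOf_apply_eq d
  have hkerS : φ.toMonoidHom.ker ≤ S := fun g hg => hker g hg d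
  obtain ⟨n, hn⟩ := exists_comap_span_pow_le_of_isOpen φ hφ S hSopen hkerS
  obtain ⟨e, he⟩ := hD d
  -- the layer `L = L_{n+e}`: open, normal, `L ≤ L_n ≤ S`
  let L : Subgroup G :=
    (AddSubgroup.toSubgroup (Ideal.span {(p : ℤ_[p]) ^ (n + e)}).toAddSubgroup).comap φ.toMonoidHom
  have hLmem : ∀ σ : G, σ ∈ L ↔ (p : ℤ_[p]) ^ (n + e) ∣ (φ σ).toAdd := fun σ =>
    mem_comap_span_pow_iff φ (n + e) σ
  haveI hLn : L.Normal := Subgroup.Normal.comap inferInstance _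
  have hLopen : IsOpen (L : Set G) := isOpen_comap_span_pow φ (n + e)
  have hLS : L ≤ S := by
    intro σ hσ
    refine hn ?_
    rw [mem_comap_span_pow_iff]
    rw [hLmem] at hσ
    exact (pow_dvd_pow _ (Nat.le_add_right n e)).trans hσ
  haveI : Finite (G ⧸ L) := finite_quotient_of_mem_iff φ hγ L hLmem
  -- the `G`-module `D^L` (on which `L` acts trivially)
  let W : Submodule ℤ D := τ.invariantsOf L
  have hdW : d ∈ W := fun l => hLS l.2
  let τW : ContinuousRep G ℤ W :=
    τ.subrepresentation W (Representation.le_comap_invariants τ.toRepresentation L)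
  let X : TopRep ℤ G := τW.toTopRep
  have hXρ : ∀ (g : G) (w : W), ((X.ρ g w : W) : D) = τ g w := fun g w => rfl
  let b₀ : W := ⟨d, hdW⟩
  have hH : ∀ h ∈ L, ∀ x : X, X.ρ h x = x := fun h hh x =>
    Subtype.ext (by rw [hXρ]; exact x.2 ⟨h, hh⟩)
  have hgen : ∀ q : G ⧸ L, ∃ i : ℕ, q = (QuotientGroup.mk γ : G ⧸ L) ^ i := fun q =>
    exists_mk_eq_mk_pow φ hγ L hLmem q
  -- the norm vanishes: `S(p^{n+e}) = p^e • S(p^n) = 0`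
  have hγn : X.ρ (γ ^ p ^ n) b₀ = b₀ := by
    refine Subtype.ext ?_
    rw [hXρ]
    have hmem : γ ^ p ^ n ∈ S :=
      hn ((pow_mem_iff_of_mem_iff φ hγ _ (fun σ => mem_comap_span_pow_iff φ n σ) (p ^ n)).2 dvd_rfl)
    exact hmem
  have hb₀e : p ^ e • b₀ = 0 := Subtype.ext (by
    rw [Submodule.coe_smul_of_tower, Submodule.coe_zero]; exact he)
  have hord : orderOf (QuotientGroup.mk γ : G ⧸ L) = p ^ (n + e) := orderOf_mk_eq_pow φ hγ L hLmem
  have hNsum : geomSum γ b₀ (orderOf (QuotientGroup.mk γ : G ⧸ L)) = (0 : X) := by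
    rw [hord, pow_add, geomSum_mul_eq_smul_of_apply_eq (X := X) γ b₀ hγn]
    exact nsmul_geomSum_eq_zero' (X := X) γ b₀ hb₀e (p ^ n)
  -- the geometric cocycle of `G` with values in `D^L`, pushed to `D`
  let z : contOneCocycles X := geomCocycle (X := X) γ b₀ L hgen hLopen hH hNsum
  have hzγ : z.1 γ = b₀ := geomCocycle_apply_self (X := X) γ b₀ L hgen hLopen hH hNsum
  let zD : G → D := fun g => ((z.1 g : W) : D)
  have hzD_cont : Continuous zD := continuous_subtype_val.comp z.1.continuous
  have hzD_mul : ∀ a b : G, zD (a * b) = zD a + τ a (zD b) := fun a b => by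
    change (((z.1 (a * b)) : W) : D) = ((z.1 a : W) : D) + τ a ((z.1 b : W) : D)
    rw [z.2 a b, Submodule.coe_add, hXρ]
  refine ⟨⟨⟨zD, hzD_cont⟩, fun a b => hzD_mul a b⟩, ?_⟩
  change ((z.1 γ : W) : D) = d
  rw [hzγ]

end KM4

/-! ### `res : H¹(G, B) ↠ H¹(N, B)^{γ}` for `G ⧸ N ≅ ℤ_p` -/

section Onto

variable {G : Type u} [Group G] [TopologicalSpace G] [IsTopologicalGroup G] [CompactSpace G]
  [T2Space G] [TotallyDisconnectedSpace G]
  {p : ℕ} [hp : Fact p.Prime]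
variable {B : Type u} [AddCommGroup B] [TopologicalSpace B] [DiscreteTopology B]

/-- The cyclic subgroup generated by `1 ∈ ℤ_p` is dense in (multiplicative) `ℤ_p`. [folklore] -/
private theorem dense_zpowers_ofAdd_one :
    Dense ((zpowers (Multiplicative.ofAdd (1 : ℤ_[p]))) : Set (Multiplicative ℤ_[p])) := by
  have hd : DenseRange (fun n : ℤ => Multiplicative.ofAdd ((n : ℤ_[p]))) :=
    (Multiplicative.ofAdd.surjective.denseRange).comp PadicInt.denseRange_intCast continuous_ofAdd
  refine hd.mono ?_
  rintro _ ⟨n, rfl⟩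
  refine ⟨n, ?_⟩
  change Multiplicative.ofAdd (1 : ℤ_[p]) ^ (n : ℤ) = Multiplicative.ofAdd ((n : ℤ_[p]))
  rw [← ofAdd_zsmul, zsmul_one]

/-- **`res : H¹(G, B) → H¹(N, B)` is onto the `γ`-invariant classes for `G ⧸ N ≅ ℤ_p`.**  For `G`
profinite, `κ : G → ℤ_p` continuous with `N = ker κ` (membership equivalence) and `κ γ = 1`, and `B` a
discrete `G`-module every element of which is killed by a power of `p`: every class `y ∈ H¹(N, B)` with
`γ • y = y` is the restriction of a class of `H¹(G, B)`; equivalently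
`0 → H¹(G/N, B^N) → H¹(G, B) → H¹(N, B)^{Γ} → 0`, `Γ = G ⧸ N ≅ ℤ_p`, is exact on the right
(inflation–restriction with `H²(Γ, B^N) = 0`, `cd_p ℤ_p = 1`).  Proof: a continuous section
`σ : ℤ_p → G` of `κ` (through the `p`-part of `γ`) gives the closed procyclic complement `C = σ(ℤ_p)`,
the retraction `r = σ ∘ κ` with kernel `N`, and the generator `ψ = σ(1) ≡ γ (mod N)`; (KM4) for `C ≅ ℤ_p`
is `exists_contOneCocycles_apply_eq_of_padicInt`, and the cocycle-extension theorem
`exists_resSubgroup_eq_of_conjMap_eq` concludes.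
[cite: NeukirchSchmidtWingberg2008, (1.6.7)] [cite: SerreGaloisCohomology1997, I §2.6 (b)]
[cite: GreenbergLNM1716, §3–§4 (surjectivity of `H¹(K_Σ/K, M) → H¹(K_Σ/K_∞, M)^Γ`, Lemma 4.6)] -/
theorem exists_resSubgroup_eq_of_conjMap_eq_of_padicInt (τ : ContinuousRep G ℤ B)
    (hB : ∀ b : B, ∃ e : ℕ, p ^ e • b = 0) (κ : G →ₜ* Multiplicative ℤ_[p]) (N : Subgroup G) [N.Normal]
    (hN : ∀ g : G, g ∈ N ↔ κ g = 1) {γ : G} (hγ : κ γ = Multiplicative.ofAdd 1)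
    (yc : continuousCohomology 1 (subgroupRep τ.toTopRep N)) (hinv : conjMap τ.toTopRep N γ 1 yc = yc) :
    ∃ xc : continuousCohomology 1 τ.toTopRep, resSubgroup τ.toTopRep N 1 xc = yc := by
  classical
  obtain ⟨σ, hσ⟩ := exists_continuousMonoidHom_section_padicInt κ γ hγ
  have hσinj : Injective σ := fun a b hab => by rw [← hσ a, ← hσ b, hab]
  -- the complement `C = σ(ℤ_p)` and the retraction `r = σ ∘ κ`
  let C : Subgroup G := σ.toMonoidHom.range
  let r : G →ₜ* G := σ.comp κ
  have hr : ∀ g, r g = σ (κ g) := fun _ => rfl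
  have hrC : ∀ g, r g ∈ C := fun g => ⟨κ g, rfl⟩
  have hrid : ∀ c ∈ C, r c = c := by
    rintro _ ⟨y, rfl⟩
    change σ (κ (σ y)) = σ y
    rw [hσ]
  have hker : ∀ g, r g = 1 ↔ g ∈ N := fun g => by
    rw [hN, hr]
    constructor
    · intro h
      rw [← hσ (κ g), h, map_one]
    · intro h
      rw [h, map_one]
  -- the generator `ψ = σ(1)` of `C`, dense powers
  let ψ : C := ⟨σ (Multiplicative.ofAdd 1), ⟨Multiplicative.ofAdd 1, rfl⟩⟩
  let f : Multiplicative ℤ_[p] → C := fun y => ⟨σ y, ⟨y, rfl⟩⟩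
  have hfcont : Continuous f := σ.continuous_toFun.subtype_mk _
  have hfsurj : Surjective f := by
    rintro ⟨_, ⟨y, rfl⟩⟩
    exact ⟨y, rfl⟩
  have hdense : Dense (zpowers ψ : Set C) := by
    have hd : Dense (f '' (zpowers (Multiplicative.ofAdd (1 : ℤ_[p])) : Set (Multiplicative ℤ_[p]))) :=
      hfsurj.denseRange.dense_image hfcont dense_zpowers_ofAdd_one
    refine hd.mono ?_
    rintro _ ⟨_, ⟨k, rfl⟩, rfl⟩
    refine ⟨k, Subtype.ext ?_⟩
    change ((ψ ^ k : C) : G) = σ (Multiplicative.ofAdd (1 : ℤ_[p]) ^ k)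
    rw [Subgroup.coe_zpow, map_zpow]
  -- (KM4) for `C ≅ ℤ_p`
  have hCclosed : IsClosed (C : Set G) := by
    have : (C : Set G) = Set.range σ := by
      ext g; constructor
      · rintro ⟨y, rfl⟩; exact ⟨y, rfl⟩
      · rintro ⟨y, rfl⟩; exact ⟨y, rfl⟩
    rw [this]
    exact (isCompact_range σ.continuous_toFun).isClosed
  haveI : CompactSpace C := isCompact_iff_compactSpace.mp hCclosed.isCompact
  let τC : ContinuousRep C ℤ B := τ.restrict (subgroupIncl C)
  let φC : C →ₜ* Multiplicative ℤ_[p] := κ.comp (subgroupIncl C)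
  have hφC : ∀ c : C, φC c = κ (c : G) := fun _ => rfl
  have hφCsurj : Surjective φC := fun y => ⟨f y, by rw [hφC]; exact hσ y⟩
  have hφCker : ∀ c : C, φC c = 1 → ∀ b : B, τC c b = b := by
    rintro ⟨_, ⟨y, rfl⟩⟩ h b
    rw [hφC] at h
    change κ (σ y) = 1 at h
    rw [hσ] at h
    subst h
    change τ (σ 1) b = b
    rw [map_one, map_one]; rfl
  have hφCψ : φC ψ = Multiplicative.ofAdd 1 := by rw [hφC]; exact hσ _
  have hKM4 : ∀ t : B, ∃ y : contOneCocycles (subgroupRep τ.toTopRep C), y.1 ψ = t := fun t => by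
    obtain ⟨z, hz⟩ := exists_contOneCocycles_apply_eq_of_padicInt φC τC hφCsurj hφCker hφCψ hB t
    exact ⟨z, hz⟩
  -- `ψ ≡ γ (mod N)`, so `yc` is `ψ`-invariant too
  have hmemN : (σ (Multiplicative.ofAdd 1)) * γ⁻¹ ∈ N := by
    rw [hN, map_mul, map_inv, hσ, hγ, mul_inv_cancel]
  have hinvψ : conjMap τ.toTopRep N (ψ : G) 1 yc = yc := by
    have hψ : ((ψ : C) : G) = (σ (Multiplicative.ofAdd 1) * γ⁻¹) * γ := by
      rw [inv_mul_cancel_right]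
    rw [hψ, ← conjMap_conjMap, hinv, conjMap_eq_self_of_mem_one τ.toTopRep N hmemN]
  exact exists_resSubgroup_eq_of_conjMap_eq τ.toTopRep τ.continuous_smul r hrC hrid hker hdense hKM4
    yc hinvψ

/-- **`range res = H¹(N, B)^{G}` for `G ⧸ N ≅ ℤ_p`** (`N = ker κ`, `κ γ = 1`, `B` discrete `p`-primary):
a class of `H¹(N, B)` is restricted from `G` iff it is `G`-invariant, iff it is `γ`-invariant.
[cite: NeukirchSchmidtWingberg2008, (1.6.7)] [cite: GreenbergLNM1716, §3] -/
theorem exists_resSubgroup_eq_iff_conjMap_eq_of_padicInt (τ : ContinuousRep G ℤ B)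
    (hB : ∀ b : B, ∃ e : ℕ, p ^ e • b = 0) (κ : G →ₜ* Multiplicative ℤ_[p]) (N : Subgroup G) [N.Normal]
    (hN : ∀ g : G, g ∈ N ↔ κ g = 1) {γ : G} (hγ : κ γ = Multiplicative.ofAdd 1)
    (yc : continuousCohomology 1 (subgroupRep τ.toTopRep N)) :
    (∃ xc : continuousCohomology 1 τ.toTopRep, resSubgroup τ.toTopRep N 1 xc = yc) ↔
      conjMap τ.toTopRep N γ 1 yc = yc := by
  constructor
  · rintro ⟨xc, rfl⟩
    exact conjMap_resSubgroup_one τ.toTopRep N γ xc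
  · exact exists_resSubgroup_eq_of_conjMap_eq_of_padicInt τ hB κ N hN hγ yc

/-- The same with invariance under all of `G`. [cite: NeukirchSchmidtWingberg2008, (1.6.7)] -/
theorem exists_resSubgroup_eq_iff_forall_conjMap_eq_of_padicInt (τ : ContinuousRep G ℤ B)
    (hB : ∀ b : B, ∃ e : ℕ, p ^ e • b = 0) (κ : G →ₜ* Multiplicative ℤ_[p]) (N : Subgroup G) [N.Normal]
    (hN : ∀ g : G, g ∈ N ↔ κ g = 1) {γ : G} (hγ : κ γ = Multiplicative.ofAdd 1)
    (yc : continuousCohomology 1 (subgroupRep τ.toTopRep N)) :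
    (∃ xc : continuousCohomology 1 τ.toTopRep, resSubgroup τ.toTopRep N 1 xc = yc) ↔
      ∀ g : G, conjMap τ.toTopRep N g 1 yc = yc := by
  constructor
  · rintro ⟨xc, rfl⟩ g
    exact conjMap_resSubgroup_one τ.toTopRep N g xc
  · intro h
    exact exists_resSubgroup_eq_of_conjMap_eq_of_padicInt τ hB κ N hN hγ yc (h γ)

end Onto

end Literature.NumberTheory.GaloisRepresentations

end
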